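import Summits.ABC.IUTFork.Cor312LicenceTameExactRealising
import Summits.ABC.IUTFork.Cor312LicenceShallowMultiSlotGenuineKInhabited
import HarnessLib

/-!
# [IUTchIII] Cor. 3.12, branch C — at all-tame GENUINE `K`-level data the per-datum hull licence (and the S_H antecedent)
# is ONE explicit integer predicate: `∀ bad w | p, ∀ j ≤ l⋆: e_p·((j²·P_w − 1) div e_p) + 1 − j·(e_p − 1) ≤ P_w`, `2l·P_w = e(w|v)·ord_v(q_v)`

PROOF-ONLY record file (no `def`, no new `Prop`, no instance) of the abc-iut cell (WAVE-5 prover seat abc-iut-w5-d009, gen 10; row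
«GENUINE-WINDOW-EXACT», part 2 of 2). TAKES NO SIDE on [IUTchIII] Cor. 3.12 or on any author. Reads part 1
(`Cor312LicenceTameExactRealising.lean`: for REALISING ideles with INTEGRAL q-degrees over uniformly tame bad fibres,
`Licence ↔ ∀ bad w ∀ j: e_p·((j²·P_w − 1) div e_p) + 1 − j·(e_p − 1) ≤ P_w`, and the same for branch C's antecedent) at the GENUINE `K`-level
Dupuy–Hilado datum `X := Cor312Prov.pilotDataOfK D K` of a collection of initial Θ-data `D` ([IUTchI] Def. 3.1), where the q-degrees are
integral for free: `P_q(w) = P_w ∈ ℕ`, `P_w ≥ 1`, `2l·P_w = e(w|v)·ord_v(q_v)` ([IUTchI] Ex. 3.2 (iv): `2l ∣ ord_w(q)`; this lineage's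
`exists_nat_qPilot_pilotDataOfK`, p445626 ✓). This CLOSES, at all-tame genuine data, the undecided strip left by this lineage's necessary
(p443270 ✓, `(l⋆−1)·P_w ≤ e_w − 1`) and sufficient (p445626 ✓, `m_p·(l⋆²−1)·P_w ≤ l⋆·e_w·(m_p−1)`) conditions.

WHAT IS PROVED (namespace `Summit.ABC.IUTFork.Cor312Prov`; Θ- and q-ideles REALISING the pilot divisors of `X`; every place `x` of `K` over a
prime `p` below a bad place tame with the same `e(x|p) = e_p ≤ p − 2`, `p > 2`):
* **`licence_settingPrVolSharp_pilotDataOfK_iff_of_tame`** — abc-iut-c312-1's `Thm311ToCor312.Licence` at abc-iut-c312-7's `settingPrVolSharp X …`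
  holds IFF at every bad `w | p` and every label `j = i+1 ∈ 𝔽_l^⋇`, for THE natural number `P_w = P_q(w)`:
  `e_p·((j²·P_w − 1) div e_p) + 1 − j·(e_p − 1) ≤ P_w`;
* **`licence_settingPrVolSharp_pilotDataOfK_iff_of_tame_explicit`** — the same with `P_w = e(w|v)·ord_v(q_v)/(2l)` spelled out
  (`v = w ∩ 𝓞_F`; `ord_v(q_v)` = abc-iut-L5-t2's `qParamOrd E v`; `e(w|v)` = Mathlib's `ramificationIdx'`);
* **`exists_qPinned_and_hull_settingPrVolSharp_pilotDataOfK_iff_of_tame`** — branch C's per-datum antecedent «∃ ρ qK, QPinned ∧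
  PilotKummerCompatHull» (any columns) ⟺ the same predicate: the per-datum form of the S_H hypothesis of the line of record `abc_of_SH_v6K`
  (whose ∀-form `Conditional.not_hSH_v6K` refutes) is DECIDED at such data.

READING (numbers, not adjectives; nothing about print): in OUR sharp containers, with Dupuy–Hilado's typed (Ind2) acting independently on
every (capsule slot, place), the per-datum S_H / (xi-f)-licence question at an all-tame genuine `K`-level datum is a DECIDABLE arithmetic
predicate of `(e(w|p), e(w|v)·ord_v(q_v)/(2l), j)` over the bad places; gen 9's legs are the cases `necessary_leg_of_tame_exact` /
`tame_exact_of_sufficient_leg` (part 1 §1) of this predicate, and the strip between them is decided both ways (part 1's integer examples).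
`K/ℚ` need not be Galois (uniform tameness over each bad prime is a hypothesis, as in p445547 / p445626). Existence of initial Θ-data
meeting the hypotheses is NOT claimed here. HONEST SCOPE: OUR containers; STRONGER-THAN-PRINT hull licence (referee lanes A1/A2); nothing
about the printed GLOBAL inequality or the NUMBER-level corollary; refuted-as-typed ≠ refuted-in-print; nothing asserts or refutes [IUTchIII]
Cor. 3.12; typed ≠ proved; instantiated ≠ endorsed.
[cite: Mochizuki2012, IUTchI Def. 3.1 (b),(c) pp. 61–62; Ex. 3.2 (iv) p. 71; IUTchIII Cor. 3.12 p. 173–175, Step (xi) (xi-f) p. 184, Thm. 3.11 (i) (Ind2) p. 154]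
[cite: DupuyHilado2025, §3.3, §3.4, §3.9, §4.9] [cite: NeukirchANT1999, Ch. II Prop. (5.5), (6.8)] [claim: Mochizuki2012, status: disputed]
for every IUT sentence quoted.
-/

noncomputable section

open Set Function NumberField IsDedekindDomain
open scoped Pointwise

/-! ## The GENUINE `K`-level datum: the licence and branch C's antecedent are the exact predicate in `P_w`, `2l·P_w = e(w|v)·ord_v(q_v)` -/

namespace Summit.ABC.IUTFork.Cor312Prov

open Thm311 Thm311.Real Cor312 Cor312.Setting Cor312Vol Literature.IUT.LogThetaLattice Literature.IUT.LogVolume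
  Literature.IUT.HodgeTheaters
open Literature.NumberTheory.NumberFields Literature.NumberTheory.GaloisRepresentations.Ultrametric

variable {F K Fbar : Type} [Field F] [NumberField F] [Field K] [NumberField K] [Algebra F K] [Field Fbar]
  [Algebra F Fbar] [Algebra K Fbar] {E : WeierstrassCurve F} [E.IsElliptic] {l : ℕ} {Pb : BadPlacePredicates K}
  (D : InitialThetaData F K Fbar E l Pb) {logv : PadicLogs K} (hlog : LogvAnalytic logv)
  (M : Type) [Field M] [NumberField M]
  (archPk : ∀ (j : (thetaIndex (pilotDataOfK D K)).Label) (vQ : (thetaIndex (pilotDataOfK D K)).VQ),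
    Set ((logShellsDH (pilotDataOfK D K) logv).Packet j vQ))
  (archSub : ∀ (j : (thetaIndex (pilotDataOfK D K)).Label) (v : (thetaIndex (pilotDataOfK D K)).V),
    Set ((logShellsDH (pilotDataOfK D K) logv).Packet j ((thetaIndex (pilotDataOfK D K)).over v)))
  (Ψ : ℤ → ∀ v : (thetaIndex (pilotDataOfK D K)).V, v ∈ (thetaIndex (pilotDataOfK D K)).Vbad →
    Set ((logShellsDH (pilotDataOfK D K) logv).StarPacket v))
  (act : ℤ → ∀ v : (thetaIndex (pilotDataOfK D K)).V, v ∈ (thetaIndex (pilotDataOfK D K)).Vbad →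
    (logShellsDH (pilotDataOfK D K) logv).StarPacket v → Module.End ℚ ((logShellsDH (pilotDataOfK D K) logv).StarPacket v))
  (Mmod : ℤ → ∀ j : (thetaIndex (pilotDataOfK D K)).LabelStar, Set ((logShellsDH (pilotDataOfK D K) logv).GlobalPacket j.1))
  (region : ℤ → ∀ j : (thetaIndex (pilotDataOfK D K)).LabelStar, FinDivisor M → ∀ vQ : (thetaIndex (pilotDataOfK D K)).VQ,
    Set ((logShellsDH (pilotDataOfK D K) logv).Packet j.1 vQ))
  (n : ℤ) {HT : Type} {LogLink : HT → HT → Type} {IsFull : ∀ {s t : HT}, LogLink s t → Prop}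
  (lat : LGPGaussianLogThetaLattice LogLink IsFull)
  {Frd : Type} {IsoF : Frd → Frd → Type} {Ob : Frd → Type} {realify : Frd → Frd} {Strip : Type}
  {IsoS : Strip → Strip → Type} {Mv : ∀ v : (thetaIndex (pilotDataOfK D K)).V, v ∈ (thetaIndex (pilotDataOfK D K)).Vbad → Type}
  [∀ v h, Monoid (Mv v h)]
  (sig : GlobalLGPFrobenioidSignature (thetaIndex (pilotDataOfK D K)).lstar (thetaIndex (pilotDataOfK D K)).V
    (· ∈ (thetaIndex (pilotDataOfK D K)).Vbad) Frd IsoF Ob realify Strip IsoS Mv)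
  (split : SplittingMonoids Mv) {ObΔ : Type} {N : ∀ v : (thetaIndex (pilotDataOfK D K)).V, v ∈ (thetaIndex (pilotDataOfK D K)).Vbad → Type}
  [∀ v h, Monoid (N v h)] (qData : QPilotData ObΔ N)
  (tq : ∀ (pp : Nat.Primes) (x : (thetaIndex (pilotDataOfK D K)).Fibre (.inr pp)),
    haveI : Fact (pp : ℕ).Prime := ⟨pp.2⟩; kOf (pilotDataOfK D K) pp.1 x)
  (t : ∀ (pp : Nat.Primes) (_ : Fin (pilotDataOfK D K).lstar) (x : (thetaIndex (pilotDataOfK D K)).Fibre (.inr pp)),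
    haveI : Fact (pp : ℕ).Prime := ⟨pp.2⟩; kOf (pilotDataOfK D K) pp.1 x)
  (htq0 : ∀ pp x, tq pp x ≠ 0)
  (htq1 : ∀ (pp : Nat.Primes) (x : (thetaIndex (pilotDataOfK D K)).Fibre (.inr pp)),
    haveI : Fact (pp : ℕ).Prime := ⟨pp.2⟩; placeOf (pilotDataOfK D K) pp.1 x ∉ (pilotDataOfK D K).S → ‖tq pp x‖ = 1)
  (col : ℤ → Column (logShellsDH (pilotDataOfK D K) logv))
  (ht0 : ∀ pp i x, t pp i x ≠ 0)
  (ht : ∀ (pp : Nat.Primes) (i : Fin (pilotDataOfK D K).lstar) (x : (thetaIndex (pilotDataOfK D K)).Fibre (.inr pp)),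
    haveI : Fact (pp : ℕ).Prime := ⟨pp.2⟩
    Real.log ‖t pp i x‖ = -((pilotDataOfK D K).thetaPilot i (placeOf (pilotDataOfK D K) pp.1 x)) *
      logNorm K (placeOf (pilotDataOfK D K) pp.1 x) / localDegree K (placeOf (pilotDataOfK D K) pp.1 x))
  (htq : ∀ (pp : Nat.Primes) (x : (thetaIndex (pilotDataOfK D K)).Fibre (.inr pp)),
    haveI : Fact (pp : ℕ).Prime := ⟨pp.2⟩
    Real.log ‖tq pp x‖ = -((pilotDataOfK D K).qPilot (placeOf (pilotDataOfK D K) pp.1 x)) *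
      logNorm K (placeOf (pilotDataOfK D K) pp.1 x) / localDegree K (placeOf (pilotDataOfK D K) pp.1 x))

include ht0 ht htq in
/-- **PER DATUM, AT ALL-TAME GENUINE `K`-LEVEL DATA THE (xi-f) LICENCE IS DECIDED EXACTLY.** For Θ- and q-ideles REALISING the pilot
divisors of `X := pilotDataOfK D K` ([IUTchI] Def. 3.1 initial Θ-data `D`): if every place `x` of `K` over a prime `p` below a bad place is
tame with the same index `e(x|p) = e_p ≤ p − 2` (`p > 2`), then abc-iut-c312-1's `Thm311ToCor312.Licence` holds at abc-iut-c312-7's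
`settingPrVolSharp X …` **iff** at every bad place `w | p` and every label `j = i+1 ∈ 𝔽_l^⋇`, for THE natural number `P_w = P_q(w)`
(`2l·P_w = e(w|v)·ord_v(q_v)`, `exists_nat_qPilot_pilotDataOfK`): `e_p·((j²·P_w − 1) div e_p) + 1 − j·(e_p − 1) ≤ P_w`.
Gen 9's legs are the cases `necessary_leg_of_tame_exact` / `tame_exact_of_sufficient_leg` of this predicate; nothing is left undecided at
such data. [cite: Mochizuki2012, IUTchI Def. 3.1 (b),(c) pp. 61–62; Ex. 3.2 (iv) p. 71; IUTchIII Step (xi) (xi-f) p. 184, Thm. 3.11 (i) (Ind2) p. 154]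
[cite: DupuyHilado2025, §3.3, §3.4, §4.9] [claim: Mochizuki2012, status: disputed] -/
theorem licence_settingPrVolSharp_pilotDataOfK_iff_of_tame (e : Nat.Primes → ℕ)
    (htame : ∀ (pp : Nat.Primes) (x : (thetaIndex (pilotDataOfK D K)).Fibre (.inr pp)),
      haveI : Fact (pp : ℕ).Prime := ⟨pp.2⟩
      (∃ w : (thetaIndex (pilotDataOfK D K)).Fibre (.inr pp), placeOf (pilotDataOfK D K) pp.1 w ∈ (pilotDataOfK D K).S) →
        2 < (pp : ℕ) ∧ e pp ≤ (pp : ℕ) - 2 ∧ (placeOf (pilotDataOfK D K) pp.1 x).asIdeal.ramificationIdx ℤ = e pp) :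
    Thm311ToCor312.Licence
        (settingPrVolSharp (pilotDataOfK D K) hlog M archPk archSub Ψ act Mmod region n lat sig split qData tq t htq0 htq1) ↔
      ∀ (pp : Nat.Primes) (i : Fin (pilotDataOfK D K).lstar) (w : (thetaIndex (pilotDataOfK D K)).Fibre (.inr pp)),
        haveI : Fact (pp : ℕ).Prime := ⟨pp.2⟩
        placeOf (pilotDataOfK D K) pp.1 w ∈ (pilotDataOfK D K).S →
          ∀ P : ℕ, (pilotDataOfK D K).qPilot (placeOf (pilotDataOfK D K) pp.1 w) = P →
            (e pp : ℤ) * (((((i : ℕ) + 1 : ℕ) : ℤ) ^ 2 * (P : ℤ) - 1) / e pp) + 1 -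
              ((i : ℕ) + 1 : ℕ) * ((e pp : ℤ) - 1) ≤ (P : ℤ) := by
  classical
  -- THE integer q-degree at the bad places (and a dummy `1` elsewhere)
  let P : ∀ pp : Nat.Primes, (thetaIndex (pilotDataOfK D K)).Fibre (.inr pp) → ℕ := fun pp w =>
    haveI : Fact (pp : ℕ).Prime := ⟨pp.2⟩
    if h : placeOf (pilotDataOfK D K) pp.1 w ∈ (pilotDataOfK D K).S then (exists_nat_qPilot_pilotDataOfK D h).choose else 1
  have hP : ∀ (pp : Nat.Primes) (w : (thetaIndex (pilotDataOfK D K)).Fibre (.inr pp)),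
      haveI : Fact (pp : ℕ).Prime := ⟨pp.2⟩
      placeOf (pilotDataOfK D K) pp.1 w ∈ (pilotDataOfK D K).S →
        (pilotDataOfK D K).qPilot (placeOf (pilotDataOfK D K) pp.1 w) = P pp w := by
    intro pp w hw
    haveI : Fact (pp : ℕ).Prime := ⟨pp.2⟩
    simp only [P, dif_pos hw]
    exact (exists_nat_qPilot_pilotDataOfK D hw).choose_spec.1
  have hP1 : ∀ (pp : Nat.Primes) (w : (thetaIndex (pilotDataOfK D K)).Fibre (.inr pp)),
      haveI : Fact (pp : ℕ).Prime := ⟨pp.2⟩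
      placeOf (pilotDataOfK D K) pp.1 w ∈ (pilotDataOfK D K).S → 1 ≤ P pp w := by
    intro pp w hw
    haveI : Fact (pp : ℕ).Prime := ⟨pp.2⟩
    simp only [P, dif_pos hw]
    exact (exists_nat_qPilot_pilotDataOfK D hw).choose_spec.2.1
  rw [licence_settingPrVolSharp_iff_of_realises_tame (pilotDataOfK D K) hlog M archPk archSub Ψ act Mmod region n lat sig split qData
    tq t htq0 htq1 ht0 ht htq e htame P hP hP1]
  refine forall₃_congr fun pp i w => forall_congr' fun hw => ?_
  haveI : Fact (pp : ℕ).Prime := ⟨pp.2⟩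
  constructor
  · intro h P' hP'
    have hPP : P pp w = P' := by
      have := (hP pp w hw).symm.trans hP'
      exact_mod_cast this
    rw [← hPP]
    exact h
  · intro h
    exact h (P pp w) (hP pp w hw)

include ht0 ht htq in
/-- **The same with `P_w` SPELLED OUT**: `P_w = e(w|v)·ord_v(q_v)/(2l)` (exact division in `ℕ`; `v = w ∩ 𝓞_F`, `ord_v(q_v)` = abc-iut-L5-t2's
`qParamOrd E v`, `e(w|v)` = Mathlib's `ramificationIdx'`). So at all-tame genuine data the licence is the arithmetic predicate
`∀ bad w | p, ∀ j ≤ l⋆: e_p·((j²·e(w|v)·ord_v(q_v)/(2l) − 1) div e_p) + 1 − j·(e_p − 1) ≤ e(w|v)·ord_v(q_v)/(2l)` of the datum's invariants.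
[cite: Mochizuki2012, IUTchI Ex. 3.2 (iv) p. 71] [cite: DupuyHilado2025, §3.3, §3.4, §4.9] [claim: Mochizuki2012, status: disputed] -/
theorem licence_settingPrVolSharp_pilotDataOfK_iff_of_tame_explicit (e : Nat.Primes → ℕ)
    (htame : ∀ (pp : Nat.Primes) (x : (thetaIndex (pilotDataOfK D K)).Fibre (.inr pp)),
      haveI : Fact (pp : ℕ).Prime := ⟨pp.2⟩
      (∃ w : (thetaIndex (pilotDataOfK D K)).Fibre (.inr pp), placeOf (pilotDataOfK D K) pp.1 w ∈ (pilotDataOfK D K).S) →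
        2 < (pp : ℕ) ∧ e pp ≤ (pp : ℕ) - 2 ∧ (placeOf (pilotDataOfK D K) pp.1 x).asIdeal.ramificationIdx ℤ = e pp) :
    Thm311ToCor312.Licence
        (settingPrVolSharp (pilotDataOfK D K) hlog M archPk archSub Ψ act Mmod region n lat sig split qData tq t htq0 htq1) ↔
      ∀ (pp : Nat.Primes) (i : Fin (pilotDataOfK D K).lstar) (w : (thetaIndex (pilotDataOfK D K)).Fibre (.inr pp)),
        haveI : Fact (pp : ℕ).Prime := ⟨pp.2⟩
        placeOf (pilotDataOfK D K) pp.1 w ∈ (pilotDataOfK D K).S →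
          (e pp : ℤ) * (((((i : ℕ) + 1 : ℕ) : ℤ) ^ 2 *
              (((finBelow F K (placeOf (pilotDataOfK D K) pp.1 w)).asIdeal.ramificationIdx'
                  (placeOf (pilotDataOfK D K) pp.1 w).asIdeal *
                qParamOrd E (finBelow F K (placeOf (pilotDataOfK D K) pp.1 w)) / (2 * l) : ℕ) : ℤ) - 1) / e pp) + 1 -
              ((i : ℕ) + 1 : ℕ) * ((e pp : ℤ) - 1) ≤
            (((finBelow F K (placeOf (pilotDataOfK D K) pp.1 w)).asIdeal.ramificationIdx'
                  (placeOf (pilotDataOfK D K) pp.1 w).asIdeal *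
                qParamOrd E (finBelow F K (placeOf (pilotDataOfK D K) pp.1 w)) / (2 * l) : ℕ) : ℤ) := by
  rw [licence_settingPrVolSharp_pilotDataOfK_iff_of_tame D hlog M archPk archSub Ψ act Mmod region n lat sig split qData tq t htq0 htq1
    ht0 ht htq e htame]
  refine forall₃_congr fun pp i w => forall_congr' fun hw => ?_
  haveI : Fact (pp : ℕ).Prime := ⟨pp.2⟩
  obtain ⟨P, hP, hP1, hPeq⟩ := exists_nat_qPilot_pilotDataOfK D hw
  have h5 : 5 ≤ l := D.five_le_l
  have hdiv : (finBelow F K (placeOf (pilotDataOfK D K) pp.1 w)).asIdeal.ramificationIdx'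
        (placeOf (pilotDataOfK D K) pp.1 w).asIdeal *
      qParamOrd E (finBelow F K (placeOf (pilotDataOfK D K) pp.1 w)) / (2 * l) = P := by
    rw [← hPeq]
    exact Nat.mul_div_cancel_left P (by omega)
  rw [hdiv]
  constructor
  · intro h
    exact h P hP
  · intro h P' hP'
    have hPP : P = P' := by
      have := hP.symm.trans hP'
      exact_mod_cast this
    rw [← hPP]
    exact h

include ht0 ht htq in
/-- **PER DATUM, BRANCH C's ANTECEDENT «∃ ρ qK, QPinned ∧ PilotKummerCompatHull» AT ALL-TAME GENUINE `K`-LEVEL DATA IS THE SAME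
PREDICATE** (any columns `col`) — the per-datum form of the S_H hypothesis of the line of record `abc_of_SH_v6K`, whose ∀-form
`Conditional.not_hSH_v6K` refutes, is DECIDED at such data: it holds iff `e_p·((j²·P_w − 1) div e_p) + 1 − j·(e_p − 1) ≤ P_w` at every bad
`w | p` and every label. [cite: Mochizuki2012, IUTchI Def. 3.1 (b),(c) pp. 61–62; Ex. 3.2 (iv) p. 71; IUTchIII Step (xi) (xi-f) p. 184]
[cite: DupuyHilado2025, §3.3, §3.4, §4.9] [claim: Mochizuki2012, status: disputed] -/
theorem exists_qPinned_and_hull_settingPrVolSharp_pilotDataOfK_iff_of_tame (e : Nat.Primes → ℕ)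
    (htame : ∀ (pp : Nat.Primes) (x : (thetaIndex (pilotDataOfK D K)).Fibre (.inr pp)),
      haveI : Fact (pp : ℕ).Prime := ⟨pp.2⟩
      (∃ w : (thetaIndex (pilotDataOfK D K)).Fibre (.inr pp), placeOf (pilotDataOfK D K) pp.1 w ∈ (pilotDataOfK D K).S) →
        2 < (pp : ℕ) ∧ e pp ≤ (pp : ℕ) - 2 ∧ (placeOf (pilotDataOfK D K) pp.1 x).asIdeal.ramificationIdx ℤ = e pp) :
    (∃ (ρ' : (∀ v : (thetaIndex (pilotDataOfK D K)).V, v ∈ (thetaIndex (pilotDataOfK D K)).Vbad →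
            Set ((logShellsDH (pilotDataOfK D K) logv).StarPacket v)) →
          ∀ (j : (thetaIndex (pilotDataOfK D K)).Label) (vQ : (thetaIndex (pilotDataOfK D K)).VQ),
            Set ((logShellsDH (pilotDataOfK D K) logv).Packet j vQ))
        (qK : ∀ v : (thetaIndex (pilotDataOfK D K)).V, v ∈ (thetaIndex (pilotDataOfK D K)).Vbad →
          Set ((logShellsDH (pilotDataOfK D K) logv).StarPacket v)),
        QPinned ({ toSituation := situationPrVol (pilotDataOfK D K) hlog M archPk archSub Ψ act Mmod region, col := col } :
            LatticeSituation (thetaIndex (pilotDataOfK D K)))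
          (settingPrVolSharp (pilotDataOfK D K) hlog M archPk archSub Ψ act Mmod region n lat sig split qData tq t htq0 htq1) ρ' qK ∧
        PilotKummerCompatHull ({ toSituation := situationPrVol (pilotDataOfK D K) hlog M archPk archSub Ψ act Mmod region, col := col } :
            LatticeSituation (thetaIndex (pilotDataOfK D K)))
          (settingPrVolSharp (pilotDataOfK D K) hlog M archPk archSub Ψ act Mmod region n lat sig split qData tq t htq0 htq1) ρ' qK) ↔
      ∀ (pp : Nat.Primes) (i : Fin (pilotDataOfK D K).lstar) (w : (thetaIndex (pilotDataOfK D K)).Fibre (.inr pp)),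
        haveI : Fact (pp : ℕ).Prime := ⟨pp.2⟩
        placeOf (pilotDataOfK D K) pp.1 w ∈ (pilotDataOfK D K).S →
          ∀ P : ℕ, (pilotDataOfK D K).qPilot (placeOf (pilotDataOfK D K) pp.1 w) = P →
            (e pp : ℤ) * (((((i : ℕ) + 1 : ℕ) : ℤ) ^ 2 * (P : ℤ) - 1) / e pp) + 1 -
              ((i : ℕ) + 1 : ℕ) * ((e pp : ℤ) - 1) ≤ (P : ℤ) := by
  rw [exists_qPinned_and_hull_settingPrVolSharp_iff_licence (pilotDataOfK D K) hlog M archPk archSub Ψ act Mmod region n lat sig split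
    qData tq t htq0 htq1 col (fun pp x => norm_qIdele_le_one_of_realises (pilotDataOfK D K) tq htq0 htq pp x)]
  exact licence_settingPrVolSharp_pilotDataOfK_iff_of_tame D hlog M archPk archSub Ψ act Mmod region n lat sig split qData tq t htq0 htq1
    ht0 ht htq e htame

end Summit.ABC.IUTFork.Cor312Prov

end
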